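import Mathlib
import Summits.ValiantsHypothesis.ValiantsHypothesis.Theses.LiouvilleSarnak
import Summits.ValiantsHypothesis.ValiantsHypothesis.Theorems.LiouvilleSarnakDigitalBilinearLiouvilleTtStarShortBoxes

/-!
# Route LiouvilleSarnak — crux `DigitalBilinearLiouville` (stmt-ValiantsHypothesis-14774), line
# `tt_star`: the PER-CUT quantitative form of the short-box reduction

`…TtStarShortBoxes.lean` (p828165) proved, for every cut `π` at level `n = k + m`,
`S(π) ≤ 4^m Σ_{i,j,ρ,ρ'} B_π(i,j;ρ,ρ')` (`S(π)` = the Gram sum of the open stub `stub_twoPointDigital`,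
`B_π` = the four-point sums of `λ` over the short digital boxes) and packaged the consequence for the
family of ALL cuts (`SDB(k) ⇒ stub ⇒ crux`).  Lines that work on ONE family of cuts — the
bit-interleaving `(CR)^n`, where `B_π(i,j;ρ,ρ') = Σ_{y<4^m} Π_ℓ λ(4^k y + a_ℓ + 1)` is verbatim a Cesàro
four-point Chowla sum with dilation `4^k`, or any class of cuts without a long low run — need the
single-cut statement with an explicit error, which this file records:

* ★ `twoPoint_le_of_shortBoxes_le` — if every NON-degenerate short box sum of `π` is `≤ δ 4^m`, then
  `S(π) ≤ 2 · 16^{k+m} / 2^k + δ · 16^{k+m}` (the `< 2 · 8^k` degenerate boxes `i = j` or `ρ = ρ'`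
  cost `2 · 16^n / 2^k`, exactly as in `twoPointDigital_of_shortBoxes`).

Honest framing: bookkeeping (the single-cut content of p828165, no new idea); `DigitalBilinearLiouville`,
`LiouvilleCutRank`, `AlgebraicSarnak` stay OPEN; nothing bears on VP versus VNP.  No definitions.
-/

-- the directory `ValiantsHypothesis/ValiantsHypothesis` repeats the summit name (tree layout)
set_option linter.dupNamespace false

namespace Summit.ValiantsHypothesis.ValiantsHypothesis.Theorems.LiouvilleSarnakDigitalBilinearLiouville.TtStarShortBoxesPerCut

open Finset

open Summit.ValiantsHypothesis.ValiantsHypothesis.Theorems.LiouvilleSarnakDigitalBilinearLiouville.TtStarShortBoxes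
  (twoPoint_le_shortBoxes abs_liouville_succ_cast)

/-- ★ **Per-cut bound from a short-box bound.**  At level `n = k + m`, if EVERY non-degenerate short
box sum of the cut `π` is at most `δ · 4^m` (`i ≠ j`, `ρ ≠ ρ'`), then
`Σ_{r,r'} ‖Σ_c λ(m_{rc}) λ(m_{r'c})‖² ≤ 2 · 16^{k+m} / 2^k + δ · 16^{k+m}`.  This is the single-cut
content of `twoPointDigital_of_shortBoxes`, stated so that a line working on ONE family of cuts
(e.g. the bit-interleaving `(CR)^n`, where the box sums are Cesàro four-point Chowla sums with
dilation `4^k`) can feed a family-restricted hypothesis. [folklore] -/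
theorem twoPoint_le_of_shortBoxes_le (k m : ℕ)
    (π : Fin (k + m) ⊕ Fin (k + m) ≃ Fin (2 * (k + m))) (δ : ℝ) (hδ : 0 ≤ δ)
    (hB : ∀ i j : Fin k → Bool, i ≠ j → ∀ ρ ρ' : Fin k → Bool, ρ ≠ ρ' →
      ∑ t : Fin m → Bool, ∑ s : Fin m → Bool,
        ((ArithmeticFunction.liouville
              (Nat.ofBits (fun l : Fin (2 * (k + m)) =>
                Sum.elim (Fin.append ρ s) (Fin.append i t) (π.symm l)) + 1) *
            ArithmeticFunction.liouville
              (Nat.ofBits (fun l : Fin (2 * (k + m)) =>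
                Sum.elim (Fin.append ρ s) (Fin.append j t) (π.symm l)) + 1) *
            (ArithmeticFunction.liouville
              (Nat.ofBits (fun l : Fin (2 * (k + m)) =>
                Sum.elim (Fin.append ρ' s) (Fin.append i t) (π.symm l)) + 1) *
            ArithmeticFunction.liouville
              (Nat.ofBits (fun l : Fin (2 * (k + m)) =>
                Sum.elim (Fin.append ρ' s) (Fin.append j t) (π.symm l)) + 1)) : ℤ) : ℝ) ≤
        δ * 4 ^ m) :
    (∑ r : Fin (k + m) → Bool, ∑ r' : Fin (k + m) → Bool,
      ‖∑ c : Fin (k + m) → Bool,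
        ((ArithmeticFunction.liouville
            (Nat.ofBits (fun j : Fin (2 * (k + m)) => Sum.elim r c (π.symm j)) + 1) : ℤ) : ℂ) *
        ((ArithmeticFunction.liouville
            (Nat.ofBits (fun j : Fin (2 * (k + m)) => Sum.elim r' c (π.symm j)) + 1) : ℤ) : ℂ)‖ ^ 2) ≤
    2 * 16 ^ (k + m) / 2 ^ k + δ * 16 ^ (k + m) := by
  refine (twoPoint_le_shortBoxes k m π).trans ?_
  -- the box sums
  set T : (Fin k → Bool) → (Fin k → Bool) → (Fin k → Bool) → (Fin k → Bool) → ℝ := fun i j ρ ρ' =>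
    ∑ t : Fin m → Bool, ∑ s : Fin m → Bool,
      ((ArithmeticFunction.liouville
            (Nat.ofBits (fun l : Fin (2 * (k + m)) =>
              Sum.elim (Fin.append ρ s) (Fin.append i t) (π.symm l)) + 1) *
          ArithmeticFunction.liouville
            (Nat.ofBits (fun l : Fin (2 * (k + m)) =>
              Sum.elim (Fin.append ρ s) (Fin.append j t) (π.symm l)) + 1) *
          (ArithmeticFunction.liouville
            (Nat.ofBits (fun l : Fin (2 * (k + m)) =>
              Sum.elim (Fin.append ρ' s) (Fin.append i t) (π.symm l)) + 1) *
          ArithmeticFunction.liouville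
            (Nat.ofBits (fun l : Fin (2 * (k + m)) =>
              Sum.elim (Fin.append ρ' s) (Fin.append j t) (π.symm l)) + 1)) : ℤ) : ℝ) with hT
  change (4 : ℝ) ^ m * ∑ i, ∑ j, ∑ ρ, ∑ ρ', T i j ρ ρ' ≤ 2 * 16 ^ (k + m) / 2 ^ k + δ * 16 ^ (k + m)
  -- trivial bound: every box sum is at most the number `4^m` of base points
  have hT1 : ∀ i j ρ ρ', T i j ρ ρ' ≤ 4 ^ m := by
    intro i j ρ ρ'
    simp only [hT]
    have hterm : ∀ (a b c d : ℕ),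
        (((ArithmeticFunction.liouville (a + 1) * ArithmeticFunction.liouville (b + 1) *
            (ArithmeticFunction.liouville (c + 1) * ArithmeticFunction.liouville (d + 1)) : ℤ)) : ℝ)
          ≤ 1 := by
      intro a b c d
      refine (le_abs_self _).trans (le_of_eq ?_)
      push_cast
      rw [abs_mul, abs_mul, abs_mul, abs_liouville_succ_cast, abs_liouville_succ_cast,
        abs_liouville_succ_cast, abs_liouville_succ_cast]
      norm_num
    calc _ ≤ ∑ _t : Fin m → Bool, ∑ _s : Fin m → Bool, (1 : ℝ) :=
          sum_le_sum fun t _ => sum_le_sum fun s _ => hterm _ _ _ _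
      _ = 4 ^ m := by
          simp only [sum_const, Finset.card_univ, Fintype.card_fun, Fintype.card_bool,
            Fintype.card_fin, nsmul_eq_mul, mul_one]
          push_cast
          rw [← pow_add, show (4 : ℝ) = 2 ^ 2 by norm_num, ← pow_mul, two_mul]
  have hT2 : ∀ i j ρ ρ', i ≠ j → ρ ≠ ρ' → T i j ρ ρ' ≤ δ * 4 ^ m :=
    fun i j ρ ρ' hij hρ => hB i j hij ρ ρ' hρ
  have hδ4 : (0 : ℝ) ≤ δ * 4 ^ m := by positivity
  have hcardk : ((Finset.univ : Finset (Fin k → Bool)).card : ℝ) = 2 ^ k := by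
    simp [Fintype.card_bool, Fintype.card_fin]
  have hU : ∀ i j, i ≠ j → ∑ ρ, ∑ ρ', T i j ρ ρ' ≤ 2 ^ k * (4 ^ m + 2 ^ k * (δ * 4 ^ m)) := by
    intro i j hij
    have hρ : ∀ ρ : Fin k → Bool, ∑ ρ', T i j ρ ρ' ≤ 4 ^ m + 2 ^ k * (δ * 4 ^ m) := by
      intro ρ
      rw [← Finset.add_sum_erase _ _ (mem_univ ρ)]
      refine add_le_add (hT1 i j ρ ρ) ?_
      calc ∑ ρ' ∈ univ.erase ρ, T i j ρ ρ' ≤ ∑ ρ' ∈ univ.erase ρ, δ * 4 ^ m :=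
            sum_le_sum fun ρ' hρ' => hT2 i j ρ ρ' hij (ne_of_mem_erase hρ').symm
        _ ≤ ∑ _ρ' : Fin k → Bool, δ * 4 ^ m :=
            sum_le_sum_of_subset_of_nonneg (erase_subset _ _) fun _ _ _ => hδ4
        _ = 2 ^ k * (δ * 4 ^ m) := by rw [sum_const, nsmul_eq_mul, hcardk]
    calc ∑ ρ, ∑ ρ', T i j ρ ρ' ≤ ∑ _ρ : Fin k → Bool, (4 ^ m + 2 ^ k * (δ * 4 ^ m)) :=
          sum_le_sum fun ρ _ => hρ ρ
      _ = 2 ^ k * (4 ^ m + 2 ^ k * (δ * 4 ^ m)) := by rw [sum_const, nsmul_eq_mul, hcardk]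
  have hUdiag : ∀ i, ∑ ρ, ∑ ρ', T i i ρ ρ' ≤ 2 ^ k * (2 ^ k * 4 ^ m) := by
    intro i
    calc ∑ ρ, ∑ ρ', T i i ρ ρ' ≤ ∑ _ρ : Fin k → Bool, ∑ _ρ' : Fin k → Bool, (4 : ℝ) ^ m :=
          sum_le_sum fun ρ _ => sum_le_sum fun ρ' _ => hT1 i i ρ ρ'
      _ = 2 ^ k * (2 ^ k * 4 ^ m) := by rw [sum_const, nsmul_eq_mul, hcardk, sum_const,
          nsmul_eq_mul, hcardk]
  have hpos : (0 : ℝ) ≤ 2 ^ k * (4 ^ m + 2 ^ k * (δ * 4 ^ m)) := by positivity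
  have hJ : ∀ i, ∑ j, ∑ ρ, ∑ ρ', T i j ρ ρ' ≤
      2 ^ k * (2 ^ k * 4 ^ m) + 2 ^ k * (2 ^ k * (4 ^ m + 2 ^ k * (δ * 4 ^ m))) := by
    intro i
    rw [← Finset.add_sum_erase _ _ (mem_univ i)]
    refine add_le_add (hUdiag i) ?_
    calc ∑ j ∈ univ.erase i, ∑ ρ, ∑ ρ', T i j ρ ρ'
        ≤ ∑ j ∈ univ.erase i, 2 ^ k * (4 ^ m + 2 ^ k * (δ * 4 ^ m)) :=
          sum_le_sum fun j hj => hU i j (ne_of_mem_erase hj).symm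
      _ ≤ ∑ _j : Fin k → Bool, 2 ^ k * (4 ^ m + 2 ^ k * (δ * 4 ^ m)) :=
          sum_le_sum_of_subset_of_nonneg (erase_subset _ _) fun _ _ _ => hpos
      _ = 2 ^ k * (2 ^ k * (4 ^ m + 2 ^ k * (δ * 4 ^ m))) := by
          rw [sum_const, nsmul_eq_mul, hcardk]
  have hI : ∑ i, ∑ j, ∑ ρ, ∑ ρ', T i j ρ ρ' ≤
      2 ^ k * (2 ^ k * (2 ^ k * 4 ^ m) + 2 ^ k * (2 ^ k * (4 ^ m + 2 ^ k * (δ * 4 ^ m)))) := by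
    calc ∑ i, ∑ j, ∑ ρ, ∑ ρ', T i j ρ ρ'
        ≤ ∑ _i : Fin k → Bool,
            (2 ^ k * (2 ^ k * 4 ^ m) + 2 ^ k * (2 ^ k * (4 ^ m + 2 ^ k * (δ * 4 ^ m)))) :=
          sum_le_sum fun i _ => hJ i
      _ = _ := by rw [sum_const, nsmul_eq_mul, hcardk]
  have h16 : (16 : ℝ) ^ (k + m) = 2 ^ k * (4 ^ m * (2 ^ k * (2 ^ k * (2 ^ k * 4 ^ m)))) := by
    rw [show (16 : ℝ) = 2 ^ 4 by norm_num, show (4 : ℝ) = 2 ^ 2 by norm_num]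
    simp only [← pow_mul, ← pow_add]
    congr 1
    ring
  calc (4 : ℝ) ^ m * ∑ i, ∑ j, ∑ ρ, ∑ ρ', T i j ρ ρ'
      ≤ 4 ^ m * (2 ^ k * (2 ^ k * (2 ^ k * 4 ^ m) +
          2 ^ k * (2 ^ k * (4 ^ m + 2 ^ k * (δ * 4 ^ m))))) := by gcongr
    _ = 2 * (4 ^ m * (2 ^ k * (2 ^ k * (2 ^ k * 4 ^ m)))) +
          δ * (2 ^ k * (4 ^ m * (2 ^ k * (2 ^ k * (2 ^ k * 4 ^ m))))) := by ring
    _ = 2 * 16 ^ (k + m) / 2 ^ k + δ * 16 ^ (k + m) := by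
          rw [h16]
          field_simp

end Summit.ValiantsHypothesis.ValiantsHypothesis.Theorems.LiouvilleSarnakDigitalBilinearLiouville.TtStarShortBoxesPerCut
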